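import Literature.MathematicalPhysics.QuantumLattice.BCSPairHoppingReflectionPositivity
import HarnessLib

/-!
# Koma's `π`-flux BCS lattice-fermion model in Lieb's reflection frame: the hopping through a
# cutting plane is reflection symmetric, and the reflection-positivity inequality (Koma 2022, (5.99))

T. Koma, *Nambu–Goldstone modes for superconducting lattice fermions*, arXiv:2201.13135 (2022)
[Koma2022], §2 (2.7)–(2.9), §4, §5. Koma's hopping Hamiltonian has amplitude `iκ` on every
nearest-neighbour bond of the even torus, with the sign pattern `(-1)^{x(1)+⋯+x(i-1)}` in direction
`i` — flux `π` through every plaquette — and ANTIPERIODIC boundary conditions, "the conditions for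
the canonical flux configuration" (loc. cit. after (2.9)), and these "are crucial to realize the
reflection positivity". In the reflection frame of Lieb 1994 used by the tree
(`PeierlsHubbardReflectionPositivity.lean`, `BCSPairHoppingReflectionPositivity.lean`) a hopping
matrix is manifestly reflection positive across the plane `P ⊥ e₀` iff its amplitudes through `P`
are real and nonnegative and the right half is the `Θ`-image of the left half,
`t_{Rx,Ry} = -t̄_{x,y}` [Lieb1994, eq. (4) and Lemma]. This file writes down the real gauge
representative of the `π`-flux class with this property,

  `T_π(κ)`: `t_{x,x+e_μ} = κ (-1)^{x₀+⋯+x_{μ-1}} u(x_μ)` with `u = +1` on the layers `x_μ < L/2` and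
  `x_μ = L - 1`, `u = -1` on `L/2 ≤ x_μ ≤ L - 2` (in particular `t_{x,x+e₀} = κ u(x₀)` and
  `t_{x,x+eᵢ} = κ (-1)^{x₀} v_i(x_⊥)`, `v_i` depending on the transverse coordinates only),

whose plaquettes all carry flux `π` and whose non-contractible loops carry the canonical
(Lieb–Loss) flux `(-1)^{L/2-1}` — the holonomies of Koma's (2.8)–(2.9) on the torus of even side
`L` (his `2L`) — and PROVES:

* `piFluxAmpl_reflect` — `T_π(Rx, Ry) = -T_π(x, y)` for adjacent `x, y` on the same side of `P`
  (Lieb's symmetry `Θ(K_L) = K_R`, [Lieb1994, eq. (4)]; [Koma2022, (5.28), (5.38), (5.41)]);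
* `piFluxAmpl_cut` — the amplitude through `P` is `κ` on every cut bond ([Lieb1994, p. 3,
  "`t_{lr} = |t_{lr}| ≥ 0`"]; [Koma2022, (5.37)]);
* `hamiltonian_amplLL` / `hamiltonian_amplRR` — hence Lieb's symmetrised amplitudes give back the
  SAME Hamiltonian: `H(amplLL T_π) = H(T_π) = H(amplRR T_π)` for the full pair-hopping model
  `PairHopRP.hamiltonian` (hopping + `U` + BCS pair hopping with DLS field + pairing source);
* **`partitionFn_sq_le`** — Koma's reflection-positivity inequality (5.99) for the plane `P ⊥ e₀`
  in this frame: for `κ ≥ 0`, `g ≥ 0`, `β ≥ 0`, any `U`, `B` and ANY bond field `h`,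
  `Z(h)² ≤ Z(h_LL) · Z(h_RR)`, the reflected configurations `h_LL`, `h_RR` (`fieldLL`, `fieldRR`)
  vanishing on the cut bonds [Koma2022, Cor. 5.2, (5.92)–(5.99)]; and its `β → ∞` form.

The identification of Koma's printed Hamiltonian (2.4)–(2.9), (3.5)–(3.6) with
`PairHopRP.hamiltonian (G d L) (T_π κ) (-2g(d+1)) g h B` up to an additive constant — by the
conjugation `e^{(iπ/2) Σ_{x odd} n_x}` (`Γ^{1,2}_x ↦ -Γ^{1,2}_x` on the odd sublattice, the staggered
order parameter `Σ_x (-1)^x Γ²_x` ↦ `Σ_x Γ²_x`; the `η`-analogue of Koma's `U_{1,j}` (5.12), NOT his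
`Ũ₁` frame (5.50)–(5.51), where the `Γ²` square along the reflection direction stays a difference)
and a `ℤ₂` gauge transformation [Koma2022, §4.1] — and the Gaussian-domination iteration over all
planes [Koma2022, Thm. 5.3] are NOT in this file (sequel). WHAT THIS IS NOT: no long-range order, no
statement about the Hubbard model; `κ < 0` (gauge equivalent to `-κ`) is not treated here.

## References

* [Koma2022] T. Koma, arXiv:2201.13135, (2.7)–(2.9) and the paragraph after (2.9); §4.1; §5,
  (5.22)–(5.41), Prop. 5.1, Cor. 5.2 (5.92)–(5.99).
* [Lieb1994] E. H. Lieb, Phys. Rev. Lett. 73 (1994) 2158, p. 3, eq. (4), Lemma eq. (6).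
* [LiebLoss1993] E. H. Lieb, M. Loss, *Fluxes, Laplacians, and Kasteleyn's theorem*, Duke Math. J.
  71 (1993) 337 (the canonical flux; cited via [Koma2022, ref. 27]).
-/

noncomputable section

namespace Literature.MathematicalPhysics.QuantumLattice

open Matrix Finset HubbardWave0 JWSplit PeierlsSplit NormedSpace PairHopRP LiebCutRP PairHopCutRP
open FermionTorus.Cut
open FermionTorus (shift unshift shift_unshift unshift_shift shift_injective shift_ne_unshift
  adj_iff_shift_or_unshift)

namespace KomaPiFlux

attribute [local instance] LiebCutRP.decEqTorus

variable {d L : ℕ} [NeZero L]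

/-! ### The amplitudes -/

/-- The sign of the bond `{x, x + e₀}` along the cut direction as a function of the layer `x₀`:
`+1` on the left layers and on the seam layer `L - 1`, `-1` on the right internal layers.
[cite: Koma2022, (2.8) and §4.1] [cite: Lieb1994, p. 3] -/
def axialSign (L c : ℕ) : ℝ := if c < L / 2 ∨ c = L - 1 then 1 else -1

omit [NeZero L] in
/-- `axialSign` takes the values `±1`. [cite: Koma2022, (2.8)] -/
theorem axialSign_sq (L c : ℕ) : axialSign L c * axialSign L c = 1 := by
  unfold axialSign; split_ifs <;> norm_num

omit [NeZero L] in
/-- The axial signs of a bond and of its mirror bond are opposite (bonds not through the plane):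
`axialSign L (L - 2 - c) = -axialSign L c` for `c + 1 ≠ L/2`, `c + 1 < L`. [cite: Lieb1994, eq. (4)] -/
theorem axialSign_reflect (hL : Even L) {c : ℕ} (hc1 : c + 1 ≠ L / 2) (hc2 : c + 1 < L) :
    axialSign L (L - 2 - c) = -axialSign L c := by
  obtain ⟨k, hk⟩ := hL
  have hk2 : L / 2 = k := by omega
  unfold axialSign
  rw [hk2]
  by_cases hl : c < k
  · rw [if_neg (by omega), if_pos (Or.inl hl)]
  · rw [if_pos (Or.inl (by omega)), if_neg (by omega), neg_neg]

/-- The transverse sign of the bond `{x, x + eᵢ}` (`i ≥ 1`): Koma's `(-1)^{x₁+⋯+x_{i-1}}` times the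
same layer pattern `axialSign L xᵢ` in direction `i` (so that every coordinate direction looks
alike: `t_{x,x+e_μ} = κ (-1)^{x₀+⋯+x_{μ-1}} axialSign L x_μ`, flux `π` through every plaquette, and
the non-contractible loops in every direction carry the canonical flux `∏_c axialSign L c = (-1)^{L/2-1}`
of the antiperiodic boundary condition). It depends on the transverse coordinates only.
[cite: Koma2022, (2.9) and the paragraph after it] -/
def transverseSign (x : FermionTorus (d + 1) L) (i : Fin d) : ℝ :=
  (-1) ^ (∑ k ∈ (univ : Finset (Fin d)).filter (· < i), (ofLex x k.succ : ℕ)) *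
    axialSign L (ofLex x i.succ : ℕ)

/-- The sign of the bond `{x, x + e_μ}`: `axialSign` along the cut direction `μ = 0`,
`(-1)^{x₀} · transverseSign` in the transverse directions. [cite: Koma2022, (2.8)–(2.9)] -/
def bondSign (x : FermionTorus (d + 1) L) (μ : Fin (d + 1)) : ℝ :=
  Fin.cases (axialSign L (col x)) (fun i => (-1) ^ (col x) * transverseSign x i) μ

omit [NeZero L] in
/-- `bondSign x 0 = axialSign L x₀`. [cite: Koma2022, (2.8)] -/
@[simp] theorem bondSign_zero (x : FermionTorus (d + 1) L) : bondSign x 0 = axialSign L (col x) :=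
  rfl

omit [NeZero L] in
/-- `bondSign x (i+1) = (-1)^{x₀} transverseSign x i`. [cite: Koma2022, (2.9)] -/
@[simp] theorem bondSign_succ (x : FermionTorus (d + 1) L) (i : Fin d) :
    bondSign x i.succ = (-1) ^ (col x) * transverseSign x i :=
  rfl

/-- **The `π`-flux hopping amplitudes in Lieb's gauge**, `T_π(κ)`: real, symmetric,
`T_π(x, x + e_μ) = κ · bondSign x μ`, zero on non-adjacent pairs, the same for both spins.
[cite: Koma2022, (2.7)–(2.9)] [cite: Lieb1994, p. 3 (the gauge `t_{lr} ≥ 0`)] -/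
def piFluxAmpl (κ : ℝ) : Fin 2 → FermionTorus (d + 1) L → FermionTorus (d + 1) L → ℂ :=
  fun _ x y => ((κ * ∑ μ : Fin (d + 1),
    ((if y = shift x μ then bondSign x μ else 0) + (if x = shift y μ then bondSign y μ else 0)) : ℝ) : ℂ)

/-- `T_π` is symmetric. [cite: Koma2022, (2.7)] -/
theorem piFluxAmpl_symm (κ : ℝ) (σ : Fin 2) (x y : FermionTorus (d + 1) L) :
    piFluxAmpl κ σ y x = piFluxAmpl κ σ x y := by
  unfold piFluxAmpl
  congr 2
  exact Finset.sum_congr rfl fun μ _ => add_comm _ _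

/-- `T_π` is Hermitian (real symmetric). [cite: Koma2022, (2.7)] -/
theorem piFluxAmpl_herm (κ : ℝ) (σ : Fin 2) (x y : FermionTorus (d + 1) L) :
    piFluxAmpl κ σ y x = star (piFluxAmpl κ σ x y) := by
  rw [piFluxAmpl_symm, piFluxAmpl, Complex.star_def, Complex.conj_ofReal]

/-- **`T_π(x, x + e_μ) = κ · bondSign x μ`** (`L ≥ 3`: the `2d + 2` neighbours are distinct).
[cite: Koma2022, (2.8)–(2.9)] -/
theorem piFluxAmpl_shift (h3 : 3 ≤ L) (κ : ℝ) (σ : Fin 2) (x : FermionTorus (d + 1) L) (μ : Fin (d + 1)) :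
    piFluxAmpl κ σ x (shift x μ) = ((κ * bondSign x μ : ℝ) : ℂ) := by
  have h2 : 2 ≤ L := by omega
  unfold piFluxAmpl
  congr 2
  rw [Finset.sum_eq_single μ]
  · rw [if_pos rfl, if_neg, add_zero]
    intro h
    have h' := congrArg (fun z => unshift z μ) h
    simp only [unshift_shift] at h'
    exact shift_ne_unshift h3 x μ μ h'.symm
  · intro ν _ hν
    rw [if_neg (fun h => hν (shift_injective h2 x h).symm), if_neg, add_zero]
    intro h
    have h' := congrArg (fun z => unshift z ν) h
    simp only [unshift_shift] at h'
    exact shift_ne_unshift h3 x μ ν h'.symm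
  · exact fun h => absurd (Finset.mem_univ μ) h

/-- `T_π(x + e_μ, x) = κ · bondSign x μ`. [cite: Koma2022, (2.8)–(2.9)] -/
theorem piFluxAmpl_shift' (h3 : 3 ≤ L) (κ : ℝ) (σ : Fin 2) (x : FermionTorus (d + 1) L) (μ : Fin (d + 1)) :
    piFluxAmpl κ σ (shift x μ) x = ((κ * bondSign x μ : ℝ) : ℂ) := by
  rw [piFluxAmpl_symm, piFluxAmpl_shift h3]

/-- `T_π(x - e_μ, x) = κ · bondSign (x - e_μ) μ`. [cite: Koma2022, (2.8)–(2.9)] -/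
theorem piFluxAmpl_unshift (h3 : 3 ≤ L) (κ : ℝ) (σ : Fin 2) (x : FermionTorus (d + 1) L) (μ : Fin (d + 1)) :
    piFluxAmpl κ σ (unshift x μ) x = ((κ * bondSign (unshift x μ) μ : ℝ) : ℂ) := by
  have h := piFluxAmpl_shift h3 κ σ (unshift x μ) μ
  rwa [shift_unshift] at h

/-! ### Behaviour under the reflection -/

omit [NeZero L] in
/-- The transverse sign is reflection invariant (the reflection fixes the transverse
coordinates). [cite: Koma2022, (5.22), (5.28)] -/
theorem transverseSign_reflect (x : FermionTorus (d + 1) L) (i : Fin d) :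
    transverseSign (reflect x) i = transverseSign x i := by
  simp only [transverseSign, ofLex_reflect_succ]

omit [NeZero L] in
/-- `(-1)^{(Rx)₀} = -(-1)^{x₀}` on the even torus. [cite: Lieb1994, p. 3] -/
theorem neg_one_pow_col_reflect (hL : Even L) (x : FermionTorus (d + 1) L) :
    ((-1 : ℝ) ^ col (reflect x)) = -(-1) ^ col x := by
  have hc := col_lt x
  obtain ⟨k, hk⟩ := hL
  rw [col_reflect]
  have h : ((-1 : ℝ) ^ (L - 1 - col x)) * (-1) ^ col x = -1 := by
    rw [← pow_add, show L - 1 - col x + col x = 2 * (k - 1) + 1 by omega, pow_add, pow_mul]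
    norm_num
  have h1 : ((-1 : ℝ) ^ col x) * (-1) ^ col x = 1 := by rw [← pow_add, ← two_mul, pow_mul]; norm_num
  calc ((-1 : ℝ) ^ (L - 1 - col x)) = (-1) ^ (L - 1 - col x) * ((-1) ^ col x * (-1) ^ col x) := by
        rw [h1, mul_one]
    _ = ((-1) ^ (L - 1 - col x) * (-1) ^ col x) * (-1) ^ col x := by ring
    _ = -(-1) ^ col x := by rw [h, neg_one_mul]

omit [NeZero L] in
/-- The transverse bond signs flip under the reflection: `bondSign (Rx) (i+1) = -bondSign x (i+1)`.
[cite: Koma2022, (5.28), (5.38)] [cite: Lieb1994, eq. (4)] -/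
theorem bondSign_reflect_succ (hL : Even L) (x : FermionTorus (d + 1) L) (i : Fin d) :
    bondSign (reflect x) i.succ = -bondSign x i.succ := by
  rw [bondSign_succ, bondSign_succ, transverseSign_reflect, neg_one_pow_col_reflect hL, neg_mul]

/-- The layer of `x + e₀` when `x` is not on the seam layer. [cite: Lieb1994, pp. 2–3] -/
theorem col_shift_zero_of_lt (x : FermionTorus (d + 1) L) (hx : col x + 1 < L) :
    col (shift x 0) = col x + 1 := by
  rw [col_shift_zero, Nat.one_mod_eq_one.2 (by omega), Nat.mod_eq_of_lt hx]

/-- The layer of `x + e₀` when `x` is on the seam layer. [cite: Lieb1994, pp. 2–3] -/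
theorem col_shift_zero_of_eq (x : FermionTorus (d + 1) L) (h2 : 2 ≤ L) (hx : col x + 1 = L) :
    col (shift x 0) = 0 := by
  rw [col_shift_zero, Nat.one_mod_eq_one.2 (by omega), hx, Nat.mod_self]

/-- **Lieb's reflection symmetry of `T_π` along the cut direction**: for a bond `{x, x + e₀}` with
both endpoints on the same side of the plane, `T_π(Rx, R(x + e₀)) = -T_π(x, x + e₀)`.
[cite: Lieb1994, eq. (4)] [cite: Koma2022, (5.38), (5.41)] -/
theorem piFluxAmpl_reflect_shift_zero (hL : Even L) (h4 : 4 ≤ L) (κ : ℝ) (σ : Fin 2)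
    (x : FermionTorus (d + 1) L) (hside : IsLeft L x ↔ IsLeft L (shift x 0)) :
    piFluxAmpl κ σ (reflect x) (reflect (shift x 0)) = -piFluxAmpl κ σ x (shift x 0) := by
  have h3 : 3 ≤ L := by omega
  have hc := col_lt x
  obtain ⟨k, hk⟩ := id hL
  have hk2 : L / 2 = k := by omega
  -- `x` is neither on the boundary layer `L/2 - 1` nor on the seam layer `L - 1`
  have hx1 : col x + 1 ≠ L / 2 := by
    intro h
    have hlt : col x + 1 < L := by omega
    have := hside.1 (by rw [isLeft_iff]; omega)
    rw [isLeft_iff, col_shift_zero_of_lt x hlt] at this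
    omega
  have hx2 : col x + 1 ≠ L := by
    intro h
    have h0 : col (shift x 0) = 0 := col_shift_zero_of_eq x (by omega) h
    have := hside.2 (by rw [isLeft_iff, h0]; omega)
    rw [isLeft_iff] at this
    omega
  have hlt : col x + 1 < L := by omega
  have hcol : col (reflect (shift x 0)) = L - 2 - col x := by
    rw [col_reflect, col_shift_zero_of_lt x hlt]; omega
  -- `R x = R(x + e₀) + e₀`
  have hR : reflect x = shift (reflect (shift x 0)) 0 := by
    rw [reflect_shift_zero, shift_unshift]
  rw [hR, piFluxAmpl_shift' h3, piFluxAmpl_shift h3, bondSign_zero, bondSign_zero, hcol,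
    axialSign_reflect hL hx1 hlt, mul_neg, Complex.ofReal_neg]

/-- **Lieb's reflection symmetry of `T_π` in the transverse directions**:
`T_π(Rx, R(x + eᵢ)) = -T_π(x, x + eᵢ)`, `i ≥ 1`. [cite: Lieb1994, eq. (4)] [cite: Koma2022, (5.28)] -/
theorem piFluxAmpl_reflect_shift_succ (hL : Even L) (h3 : 3 ≤ L) (κ : ℝ) (σ : Fin 2)
    (x : FermionTorus (d + 1) L) (i : Fin d) :
    piFluxAmpl κ σ (reflect x) (reflect (shift x i.succ)) = -piFluxAmpl κ σ x (shift x i.succ) := by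
  rw [reflect_shift_succ, piFluxAmpl_shift h3, piFluxAmpl_shift h3, bondSign_reflect_succ hL,
    ← Complex.ofReal_neg, mul_neg]

/-- **`T_π(Rx, Ry) = -T_π(x, y)` for adjacent `x, y` on the same side of the plane** (Lieb's
`Θ(K_L) = K_R` with `t' = -t̄ ∘ R`). [cite: Lieb1994, eq. (4)] [cite: Koma2022, (5.41)] -/
theorem piFluxAmpl_reflect (hL : Even L) (h4 : 4 ≤ L) (κ : ℝ) (σ : Fin 2)
    {x y : FermionTorus (d + 1) L} (hadj : (G d L).Adj x y) (hside : IsLeft L x ↔ IsLeft L y) :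
    piFluxAmpl κ σ (reflect x) (reflect y) = -piFluxAmpl κ σ x y := by
  have h2 : 2 ≤ L := by omega
  have h3 : 3 ≤ L := by omega
  have aux : ∀ (μ : Fin (d + 1)) (z : FermionTorus (d + 1) L), (IsLeft L z ↔ IsLeft L (shift z μ)) →
      piFluxAmpl κ σ (reflect z) (reflect (shift z μ)) = -piFluxAmpl κ σ z (shift z μ) := by
    intro μ
    refine Fin.cases ?_ (fun i => ?_) μ
    · exact fun z hz => piFluxAmpl_reflect_shift_zero hL h4 κ σ z hz
    · exact fun z _ => piFluxAmpl_reflect_shift_succ hL h3 κ σ z i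
  rcases (adj_iff_shift_or_unshift h2 x y).1 hadj with ⟨μ, rfl⟩ | ⟨μ, rfl⟩
  · exact aux μ x hside
  · -- `y = x - e_μ`, i.e. `x = y + e_μ`: use the symmetry of `T_π`
    set z := unshift x μ with hz
    have hx : x = shift z μ := by rw [hz, shift_unshift]
    rw [hx, ← piFluxAmpl_symm κ σ (reflect (shift z μ)) (reflect z), ← piFluxAmpl_symm κ σ (shift z μ) z]
    exact aux μ z (by rw [← hx]; exact hside.symm)

/-- **The amplitude through the cutting plane is `κ` on every cut bond** (`{l, Rl}`, `l` on a
boundary layer). [cite: Lieb1994, p. 3 ("`t_{lr} = |t_{lr}| ≥ 0`")] [cite: Koma2022, (5.37)] -/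
theorem piFluxAmpl_cut (hL : Even L) (h4 : 4 ≤ L) (κ : ℝ) (σ : Fin 2) (x : FermionTorus (d + 1) L)
    (hx : IsBoundary L x) : piFluxAmpl κ σ x (reflect x) = ((κ : ℝ) : ℂ) := by
  have h3 : 3 ≤ L := by omega
  rcases hx with hx | hx
  · rw [reflect_eq_shift_of_col hL hx, piFluxAmpl_shift h3, bondSign_zero]
    unfold axialSign
    rw [if_pos (Or.inl (by omega)), mul_one]
  · rw [reflect_eq_unshift_of_col_zero hx, ← piFluxAmpl_symm, piFluxAmpl_unshift h3, bondSign_zero]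
    have hc : col (unshift x 0) = L - 1 := by
      rw [col_unshift_zero, hx, Nat.one_mod_eq_one.2 (by omega), add_zero, Nat.mod_eq_of_lt (by omega)]
    unfold axialSign
    rw [hc, if_pos (Or.inr rfl), mul_one]

/-- **Lieb's left-symmetrised amplitudes of `T_π` are `T_π` on every bond.**
[cite: Lieb1994, Theorem (p. 4), "`H_L, Θ(H_L)`"] [cite: Koma2022, (5.41)] -/
theorem amplLL_piFluxAmpl (hL : Even L) (h4 : 4 ≤ L) (κ : ℝ) (σ : Fin 2) {x y : FermionTorus (d + 1) L}
    (hadj : (G d L).Adj x y) : amplLL (piFluxAmpl κ) σ x y = piFluxAmpl κ σ x y := by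
  rw [amplLL_apply]
  split_ifs with h
  · rw [← piFluxAmpl_herm, piFluxAmpl_reflect hL h4 κ σ hadj (by simp [h.1, h.2]), neg_neg]
  · rfl

/-- **Lieb's right-symmetrised amplitudes of `T_π` are `T_π` on every bond.**
[cite: Lieb1994, Theorem (p. 4), "`Θ(H_R), H_R`"] [cite: Koma2022, (5.41)] -/
theorem amplRR_piFluxAmpl (hL : Even L) (h4 : 4 ≤ L) (κ : ℝ) (σ : Fin 2) {x y : FermionTorus (d + 1) L}
    (hadj : (G d L).Adj x y) : amplRR (piFluxAmpl κ) σ x y = piFluxAmpl κ σ x y := by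
  rw [amplRR_apply]
  split_ifs with h
  · rw [← piFluxAmpl_herm, piFluxAmpl_reflect hL h4 κ σ hadj (by simp [h.1, h.2]), neg_neg]
  · rfl

/-! ### The model in Lieb's frame and Koma's reflection-positivity inequality (5.99) -/

/-- **Koma's `π`-flux BCS model in Lieb's frame**: `π`-flux hopping `T_π(κ)`, on-site `U`, BCS pair
hopping `g` with the DLS bond field `h`, pairing source `B` (Koma's printed model is the case
`U = -2g(d+1)` up to an additive constant and a gauge/`η`-rotation, see the module docstring).
[cite: Koma2022, (2.4)–(2.9), (3.5)–(3.6)] -/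
def hamiltonian (κ U g : ℝ) (h : FermionTorus (d + 1) L → FermionTorus (d + 1) L → ℝ) (B : ℝ) :
    Matrix (Finset (Orb (FermionTorus (d + 1) L))) (Finset (Orb (FermionTorus (d + 1) L))) ℂ :=
  PairHopRP.hamiltonian (G d L) (piFluxAmpl κ) U g h B

/-- `H(amplLL T_π) = H(T_π)`: the left-symmetrised model is the model itself. [cite: Koma2022, (5.92)] -/
theorem hamiltonian_amplLL (hL : Even L) (h4 : 4 ≤ L) (κ U g : ℝ)
    (h : FermionTorus (d + 1) L → FermionTorus (d + 1) L → ℝ) (B : ℝ) :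
    PairHopRP.hamiltonian (G d L) (amplLL (piFluxAmpl κ)) U g h B = hamiltonian κ U g h B := by
  rw [hamiltonian, PairHopRP.hamiltonian, PairHopRP.hamiltonian,
    peierlsHubbard_congr (G d L) (fun σ x y hxy => amplLL_piFluxAmpl hL h4 κ σ hxy) U]

/-- `H(amplRR T_π) = H(T_π)`. [cite: Koma2022, (5.92)] -/
theorem hamiltonian_amplRR (hL : Even L) (h4 : 4 ≤ L) (κ U g : ℝ)
    (h : FermionTorus (d + 1) L → FermionTorus (d + 1) L → ℝ) (B : ℝ) :
    PairHopRP.hamiltonian (G d L) (amplRR (piFluxAmpl κ)) U g h B = hamiltonian κ U g h B := by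
  rw [hamiltonian, PairHopRP.hamiltonian, PairHopRP.hamiltonian,
    peierlsHubbard_congr (G d L) (fun σ x y hxy => amplRR_piFluxAmpl hL h4 κ σ hxy) U]

/-- **Koma's reflection-positivity inequality (5.99) for the plane `P ⊥ e₀`, in Lieb's frame.**
On the even torus `(ℤ/Lℤ)^{d+1}`, `L ≥ 4`, for `κ ≥ 0`, `g ≥ 0`, `β ≥ 0`, any real `U`, `B` and any
real bond field `h`:
`(Tr e^{-βH(B,h)})² ≤ Tr e^{-βH(B,h_LL)} · Tr e^{-βH(B,h_RR)}`, where `h_LL` (`h_RR`) keeps the field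
on the left (right) bonds, carries it to the mirror bonds by the reflection, and VANISHES on the
bonds through `P` — Koma's `h⁻`, `h⁺` of (5.93)–(5.98). [cite: Koma2022, Cor. 5.2, (5.99)] [cite: Lieb1994, Lemma, eq. (6)] -/
theorem partitionFn_sq_le (hL : Even L) (h4 : 4 ≤ L) {β : ℝ} (hβ : 0 ≤ β) {κ : ℝ} (hκ : 0 ≤ κ)
    (U : ℝ) {g : ℝ} (hg : 0 ≤ g) (h : FermionTorus (d + 1) L → FermionTorus (d + 1) L → ℝ) (B : ℝ) :
    ((hamiltonian κ U g h B).partitionFn β).re ^ 2 ≤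
      ((hamiltonian κ U g (fieldLL h) B).partitionFn β).re *
        ((hamiltonian κ U g (fieldRR h) B).partitionFn β).re := by
  have h := PairHopCutRP.partitionFn_sq_le_reflected hL h4 hβ hg (tc := fun _ _ => κ)
    (fun _ _ _ => hκ) U (piFluxAmpl κ) (piFluxAmpl_herm κ) (fun σ x hx => piFluxAmpl_cut hL h4 κ σ x hx) h B
  rwa [hamiltonian_amplLL hL h4, hamiltonian_amplRR hL h4] at h

/-- The `β → ∞` form: `E₀(h_LL) + E₀(h_RR) ≤ 2 E₀(h)` for the ground-state energies over all of Fock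
space. [cite: Koma2022, (2.13), Cor. 5.2] [cite: Lieb1994, Remark (iii)] -/
theorem groundEnergy_add_le (hL : Even L) (h4 : 4 ≤ L) {κ : ℝ} (hκ : 0 ≤ κ) (U : ℝ) {g : ℝ} (hg : 0 ≤ g)
    (h : FermionTorus (d + 1) L → FermionTorus (d + 1) L → ℝ) (B : ℝ) :
    (hamiltonian κ U g (fieldLL h) B).groundEnergy + (hamiltonian κ U g (fieldRR h) B).groundEnergy ≤
      2 * (hamiltonian κ U g h B).groundEnergy := by
  have h := PairHopCutRP.groundEnergy_add_le_two_mul hL h4 hg (tc := fun _ _ => κ)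
    (fun _ _ _ => hκ) U (piFluxAmpl κ) (piFluxAmpl_herm κ) (fun σ x hx => piFluxAmpl_cut hL h4 κ σ x hx) h B
  rwa [hamiltonian_amplLL hL h4, hamiltonian_amplRR hL h4] at h

end KomaPiFlux

end Literature.MathematicalPhysics.QuantumLattice

end
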